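import Literature.Computability.FineGrained.Sweep1OVProgram
import HarnessLib

/-!
# Williams' Orthogonal Vectors algorithm on the word RAM: the main loop and the run

Continuation of `Literature.Computability.FineGrained.Sweep1OVProgram` (R. Williams, FOCS 2024 /
ECCC TR24-142, Thms. 8, 10 and 3): verification of the main loop of `OVEq.prog` in the logic
`SProg.Achieves` — the key loop (`keyLoop_spec`: `r33 := Σ_{mb<K} T[q_mb][code_mb] · Bd^mb`), the
coefficient loop (`coef_spec`), the insert loop (`insert_spec`: keys stored at `KA` and counted in
the counting array `H0 + v ↦ #{i : key_i = v}`), the count loop (`count_spec`: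
`r28 := #{(i, j) : key_i = key'_j}`), the reset loop (`reset_spec`: the counting array returns to
zero), the accumulation (`accum_spec`), one term (`qBody_spec`), the main loop (`main_spec`), the
read-out (`output_spec`), and the whole program from the initial memory (`prog_spec`,
**`prog_outputsWithin`**: at any word size `W` with `Fits W`, the compiled program outputs
`[outBit]`, `outBit = [S⁺ ≠ S⁻]`, within `Ttotal + 1` steps), together with the arithmetic of keys,
coefficients and counts in closed form (`keyA_succ`, `keyA_lt`, `mag_succ`, `sgn_succ`,
`hcount_succ`, `cnt_succ`, `Spos_succ`, …).

## References

* R. Williams, *The Orthogonal Vectors Conjecture and Non-Uniform Circuit Lower Bounds*, FOCS 2024;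
  ECCC TR24-142, §3, Thms. 8, 9, 10 and 3.
* T. Nipkow, G. Klein, *Concrete Semantics with Isabelle/HOL*, Springer 2014, §12.
-/

namespace Literature.Computability.FineGrained

open Cryptography Cryptography.WordRAM Complexity Cryptography.WordRAM.SProg

namespace OVEq

open CliqueRed (r pt im)

namespace Params

open Finset

variable (g : Params) {W : ℕ} {O : List ℕ → List ℕ}

/-! ### Arithmetic of keys, coefficients and counts -/

/-- One more block in a key. [folklore] -/
theorem keyA_succ (q i M : ℕ) :
    g.keyA q i (M + 1) = g.keyA q i M + g.tb.U (g.digit q M) (g.codeA i M) * g.tb.Bd ^ M := by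
  unfold keyA; rw [Finset.sum_range_succ]

/-- One more block in a key. [folklore] -/
theorem keyB_succ (q j M : ℕ) :
    g.keyB q j (M + 1) = g.keyB q j M + g.tb.V (g.digit q M) (g.codeB j M) * g.tb.Bd ^ M := by
  unfold keyB; rw [Finset.sum_range_succ]

/-- A sum of digits below `Bd` in base `Bd` over `M` places is below `Bd^M`. [folklore] -/
theorem sum_digits_lt {f : ℕ → ℕ} {B : ℕ} (hf : ∀ mb, f mb < B) (M : ℕ) :
    ∑ mb ∈ Finset.range M, f mb * B ^ mb < B ^ M := by
  induction M with
  | zero => simp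
  | succ M ih =>
    rw [Finset.sum_range_succ, pow_succ]
    have h1 : f M * B ^ M ≤ (B - 1) * B ^ M := Nat.mul_le_mul_right _ (by have := hf M; omega)
    have hB : 1 ≤ B := by have := hf 0; omega
    have h2 : B ^ M + (B - 1) * B ^ M = B ^ M * B := by
      obtain ⟨B', rfl⟩ := Nat.exists_eq_add_of_le hB
      rw [Nat.add_sub_cancel_left]; ring
    calc _ < B ^ M + (B - 1) * B ^ M := by omega
      _ = B ^ M * B := h2

/-- Keys over `M` blocks are below `Bd^M`. [folklore] -/
theorem keyA_lt (htb : g.tb.WF) (q i M : ℕ) : g.keyA q i M < g.tb.Bd ^ M :=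
  sum_digits_lt (fun _ => htb.U_lt _ _) M

/-- Keys over `M` blocks are below `Bd^M`. [folklore] -/
theorem keyB_lt (htb : g.tb.WF) (q j M : ℕ) : g.keyB q j M < g.tb.Bd ^ M :=
  sum_digits_lt (fun _ => htb.V_lt _ _) M

/-- One more factor of the magnitude. [folklore] -/
theorem mag_succ (q M : ℕ) : g.mag q (M + 1) = g.mag q M * g.tb.cmag (g.digit q M) := by
  unfold mag; rw [Finset.prod_range_succ]

/-- Magnitudes over `M` factors are at most `cmax^M`. [folklore] -/
theorem mag_le (htb : g.tb.WF) (q M : ℕ) : g.mag q M ≤ g.tb.cmax ^ M := by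
  induction M with
  | zero => simp [mag]
  | succ M ih => rw [mag_succ, pow_succ]; exact Nat.mul_le_mul ih (htb.cmag_le _)

/-- Sign bits are bits. [folklore] -/
theorem sgn_le (q M : ℕ) : g.sgn q M ≤ 1 := by unfold sgn; omega

/-- Xor of bits is addition modulo `2`. [folklore] -/
theorem xor_bits {a b : ℕ} (ha : a ≤ 1) (hb : b ≤ 1) : a ^^^ b = (a + b) % 2 := by
  interval_cases a <;> interval_cases b <;> decide

/-- One more factor of the sign. [folklore] -/
theorem sgn_succ (htb : g.tb.WF) (q M : ℕ) : g.sgn q (M + 1) = g.sgn q M ^^^ g.tb.csgn (g.digit q M) := by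
  rw [xor_bits (g.sgn_le q M) (htb.csgn_le _)]
  unfold sgn; rw [Finset.sum_range_succ, Nat.mod_add_mod]

/-- Digits are below `r` (for `r ≥ 1`). [folklore] -/
theorem digit_lt {q mb : ℕ} (hr : 0 < g.tb.r) : g.digit q mb < g.tb.r := Nat.mod_lt _ hr

/-- No rows counted: the counting array is zero. [folklore] -/
theorem hcount_zero (q v : ℕ) : g.hcount q 0 v = 0 := by simp [hcount]

/-- One more row counted. [folklore] -/
theorem hcount_succ (q p v : ℕ) :
    g.hcount q (p + 1) v = g.hcount q p v + if g.keyA q p g.K = v then 1 else 0 := by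
  unfold hcount; rw [Finset.range_add_one, Finset.filter_insert]
  split_ifs with h
  · rw [Finset.card_insert_of_notMem (by simp)]
  · rw [Nat.add_zero]

/-- Counts are at most the number of rows counted. [folklore] -/
theorem hcount_le (q p v : ℕ) : g.hcount q p v ≤ p := by
  unfold hcount; exact (Finset.card_filter_le _ _).trans (by simp)

/-- No columns: no pairs. [folklore] -/
theorem cnt_zero (q : ℕ) : g.cnt q 0 = 0 := by simp [cnt]

/-- One more column. [folklore] -/
theorem cnt_succ (q p : ℕ) : g.cnt q (p + 1) = g.cnt q p + g.hcount q g.n (g.keyB q p g.K) := by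
  unfold cnt; rw [Finset.sum_range_succ]

/-- Pair counts are at most `p n`. [folklore] -/
theorem cnt_le (q p : ℕ) : g.cnt q p ≤ p * g.n := by
  unfold cnt
  calc _ ≤ ∑ j ∈ Finset.range p, g.n := Finset.sum_le_sum fun j _ => g.hcount_le _ _ _
    _ = p * g.n := by simp

/-- One more term in `S⁺`. [folklore] -/
theorem Spos_succ (q : ℕ) :
    g.Spos (q + 1) = g.Spos q + if g.sgn q g.K = 0 then g.mag q g.K * g.cnt q g.n else 0 := by
  unfold Spos; rw [Finset.range_add_one, Finset.filter_insert]
  split_ifs with h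
  · rw [Finset.sum_insert (by simp), Nat.add_comm]
  · rw [Nat.add_zero]

/-- One more term in `S⁻`. [folklore] -/
theorem Sneg_succ (q : ℕ) :
    g.Sneg (q + 1) = g.Sneg q + if g.sgn q g.K ≠ 0 then g.mag q g.K * g.cnt q g.n else 0 := by
  unfold Sneg; rw [Finset.range_add_one, Finset.filter_insert]
  split_ifs with h
  · rw [Finset.sum_insert (by simp), Nat.add_comm]
  · rw [Nat.add_zero]

/-- `S⁺` over `Q` terms is at most `Q · CK · n²`. [folklore] -/
theorem Spos_le (htb : g.tb.WF) (Q : ℕ) : g.Spos Q ≤ Q * (g.CK * (g.n * g.n)) := by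
  unfold Spos
  calc _ ≤ ∑ q ∈ (Finset.range Q).filter (fun q => g.sgn q g.K = 0), g.CK * (g.n * g.n) :=
        Finset.sum_le_sum fun q _ => Nat.mul_le_mul (g.mag_le htb _ _) (g.cnt_le _ _)
    _ ≤ ∑ q ∈ Finset.range Q, g.CK * (g.n * g.n) :=
        Finset.sum_le_sum_of_subset_of_nonneg (Finset.filter_subset _ _) fun _ _ _ => Nat.zero_le _
    _ = Q * (g.CK * (g.n * g.n)) := by simp

/-- `S⁻` over `Q` terms is at most `Q · CK · n²`. [folklore] -/
theorem Sneg_le (htb : g.tb.WF) (Q : ℕ) : g.Sneg Q ≤ Q * (g.CK * (g.n * g.n)) := by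
  unfold Sneg
  calc _ ≤ ∑ q ∈ (Finset.range Q).filter (fun q => g.sgn q g.K ≠ 0), g.CK * (g.n * g.n) :=
        Finset.sum_le_sum fun q _ => Nat.mul_le_mul (g.mag_le htb _ _) (g.cnt_le _ _)
    _ ≤ ∑ q ∈ Finset.range Q, g.CK * (g.n * g.n) :=
        Finset.sum_le_sum_of_subset_of_nonneg (Finset.filter_subset _ _) fun _ _ _ => Nat.zero_le _
    _ = Q * (g.CK * (g.n * g.n)) := by simp


/-! ### The key loop -/

/-- The invariant of the key loop after `M` blocks. [folklore] -/
structure KeyInv (m : ℕ → ℕ) (q cb : ℕ) (tab : ℕ → ℕ → ℕ) (code : ℕ → ℕ) (M : ℕ) (m' : ℕ → ℕ) :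
    Prop where
  r30 : m' 30 = g.K - M
  r31 : m' 31 = g.tb.r ^ M
  r32 : m' 32 = g.tb.Bd ^ M
  r33 : m' 33 = ∑ mb ∈ Finset.range M, tab (g.digit q mb) (code mb) * g.tb.Bd ^ mb
  r34 : m' 34 = cb + M
  frame : ∀ a, (a < 30 ∨ 37 < a) → m' a = m a

set_option maxHeartbeats 1000000 in
/-- **The key loop** (table base in register `t ∈ {7, 8}`, block codes at `cb = r26`, term
`q = r17`): `r33 := Σ_{mb < K} tab[q_mb][code_mb] · Bd^mb`, `r34 := cb + K`; only the registers
`30–37` change. [folklore] -/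
theorem keyLoop_spec (hF : g.Fits W) (htb : g.tb.WF) {t : ℕ} (ht : t = 7 ∨ t = 8)
    {m : ℕ → ℕ} {q T cb : ℕ} (tab : ℕ → ℕ → ℕ) (code : ℕ → ℕ)
    (hq : q < g.RK) (r4 : m 4 = g.K) (r17 : m 17 = q) (r26 : m 26 = cb) (rt : m t = T)
    (hcb : 100 ≤ cb) (hcbK : cb + g.K ≤ g.KA) (hT100 : 100 ≤ T) (hT : T + g.tb.r * g.tb.P ≤ g.KA)
    (hcode : ∀ mb, mb < g.K → m (cb + mb) = code mb) (hcodeP : ∀ mb, code mb < g.tb.P)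
    (htabv : ∀ ℓ c, ℓ < g.tb.r → c < g.tb.P → m (T + (ℓ * g.tb.P + c)) = tab ℓ c)
    (htabB : ∀ ℓ c, tab ℓ c < g.tb.Bd) :
    Achieves W O (keyLoop g.tb t) m (g.KeyInv m q cb tab code g.K) (g.K * 14 + 6) := by
  obtain ⟨hX, hXL, hTU, hTV, hTC, hTS, hBA, hBB, hKA, hH0, htop, hxx, hdk, hrk, hbd, hprod, hL,
    hP, hnn⟩ := g.facts hF
  have hBd : 1 ≤ g.tb.Bd := by have := htb.U_lt 0 0; omega
  have hBK : ∀ M, M ≤ g.K → g.tb.Bd ^ M ≤ g.BK := fun M hM => Nat.pow_le_pow_right hBd hM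
  have ht30 : t < 30 := by omega
  unfold keyLoop
  refine Achieves.mono (T := 5 + (g.K * 14 + 1)) ?_ (fun _ h => h) (by omega)
  refine Achieves.seqs_cons (R := g.KeyInv m q cb tab code 0) (T₁ := 5) (T₂ := g.K * 14 + 1) ?_
    fun m₁ h₁ => ?_
  · refine CliqueRed.achieves_block_of_eq (fun m' hm' => ?_) le_rfl
    simp (disch := first | omega | decide) only [execOps_cons, execOps_nil, execOp, Operand.write,
      Operand.read, merge_apply_of_lt, update_merge_of_lt, Function.update_of_ne,
      BinOp.eval_band, Nat.and_self, r4, r26] at hm'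
    subst hm'
    refine ⟨?_, ?_, ?_, ?_, ?_, fun a ha => ?_⟩
    all_goals (try simp (disch := first | omega | decide) only [merge_apply_of_lt,
      Function.update_self, Function.update_of_ne, pow_zero, Finset.range_zero, Finset.sum_empty,
      Nat.add_zero, Nat.sub_zero])
    by_cases ha' : a < 100
    · rw [merge_apply_of_lt ha']; simp (disch := omega) only [Function.update_of_ne]
    · rw [merge_apply_of_le (by omega)]
  refine Achieves.seqs_cons (T₁ := g.K * 14 + 1) (T₂ := 0) ?_ (fun _ h => Achieves.seqs_nil h)
  refine Achieves.whilenz g.K 12 (fun M => g.KeyInv m q cb tab code M) (fun M hM m' hI => ⟨?_, ?_⟩)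
    (fun m' hI => ?_) h₁ (fun _ h => h) (by omega)
  · simp only [Operand.read, hI.r30]; omega
  · obtain ⟨s30, s31, s32, s33, s34, hfr⟩ := hI
    have hr : 0 < g.tb.r := by
      rcases Nat.eq_zero_or_pos g.tb.r with h0 | h; · exfalso; unfold RK at hq; rw [h0, zero_pow (by omega)] at hq; omega
      · exact h
    have hRK : ∀ M, M ≤ g.K → g.tb.r ^ M ≤ g.RK := fun M hM => Nat.pow_le_pow_right hr hM
    obtain ⟨qd, hqd⟩ : ∃ qd, q / g.tb.r ^ M = qd := ⟨_, rfl⟩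
    obtain ⟨ℓ, hℓ⟩ : ∃ ℓ, qd % g.tb.r = ℓ := ⟨_, rfl⟩
    have hdig : g.digit q M = ℓ := by unfold digit; rw [hqd, hℓ]
    have hℓr : ℓ < g.tb.r := by rw [← hℓ]; exact Nat.mod_lt _ hr
    have hℓP : ℓ * g.tb.P + g.tb.P ≤ g.tb.r * g.tb.P := by
      rw [← Nat.succ_mul]; exact Nat.mul_le_mul_right _ hℓr
    have hcM := hcodeP M
    have htv := htabB ℓ (code M)
    set psum := ∑ mb ∈ Finset.range M, tab (g.digit q mb) (code mb) * g.tb.Bd ^ mb with hpsum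
    have hps1 : psum + tab ℓ (code M) * g.tb.Bd ^ M < g.tb.Bd ^ (M + 1) := by
      have := sum_digits_lt (f := fun mb => tab (g.digit q mb) (code mb)) (B := g.tb.Bd)
        (fun mb => htabB _ _) (M + 1)
      rwa [Finset.sum_range_succ, hdig] at this
    have hBK1 := hBK (M + 1) (by omega)
    have hBKM := hBK M (by omega)
    have hRK1 := hRK (M + 1) (by omega)
    have hRKM := hRK M (by omega)
    have htabmul : tab ℓ (code M) * g.tb.Bd ^ M < 2 ^ W := by
      have : tab ℓ (code M) * g.tb.Bd ^ M ≤ psum + tab ℓ (code M) * g.tb.Bd ^ M := Nat.le_add_left _ _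
      omega
    have hpow1 : g.tb.r ^ M * g.tb.r < 2 ^ W := by rw [← pow_succ]; omega
    have hpow2 : g.tb.Bd ^ M * g.tb.Bd < 2 ^ W := by rw [← pow_succ]; omega
    -- reads
    have e17 : m' 17 = q := by rw [hfr 17 (by omega), r17]
    have et : m' t = T := by rw [hfr t (by omega), rt]
    have ecode : m' (cb + M) = code M := by rw [hfr _ (by omega), hcode M hM]
    have etab : m' (T + (ℓ * g.tb.P + code M)) = tab ℓ (code M) := by
      rw [hfr _ (by omega), htabv ℓ _ hℓr hcM]
    refine CliqueRed.achieves_block_of_eq (fun m'' hm'' => ?_) le_rfl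
    simp (disch := first | omega | decide) only [execOps_cons, execOps_nil, execOp,
      Operand.write, Operand.read, merge_apply_of_lt, merge_apply_of_le, update_merge_of_lt,
      Function.update_self, Function.update_of_ne, BinOp.eval_add_of_lt,
      BinOp.eval_sub_of_le, BinOp.eval_div, BinOp.eval_mod, BinOp.eval_band, BinOp.eval_mul_of_lt,
      Nat.and_self, s30, s31, s32, s33, s34, e17, et, hqd, hℓ, ecode, etab] at hm''
    subst hm''
    refine ⟨?_, ?_, ?_, ?_, ?_, fun a ha => ?fr⟩
    case fr =>
      by_cases ha' : a < 100
      · rw [merge_apply_of_lt ha']; simp (disch := omega) only [Function.update_of_ne]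
        exact hfr a ha
      · rw [merge_apply_of_le (by omega)]; exact hfr a ha
    all_goals (try simp (disch := first | omega | decide) only [merge_apply_of_lt,
      Function.update_self, Function.update_of_ne])
    · omega
    · rw [pow_succ]
    · rw [pow_succ]
    · rw [hpsum, Finset.sum_range_succ, hdig]
    · omega
  · simp only [Operand.read, hI.r30]; omega


/-! ### Reading the data during the main loop -/

/-- From `KA` on, the code memory is `0`. [folklore] -/
theorem codeMem_of_KA_le {a : ℕ} (ha : g.KA ≤ a) : g.codeMem a = 0 := by
  have := g.bases
  unfold codeMem codeData
  rw [if_neg (by omega), if_neg (by omega), g.tabMem_of_BA_le (by omega)]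

/-- Below `BA`, the code memory is the table memory. [folklore] -/
theorem codeMem_of_lt_BA {a : ℕ} (ha : a < g.BA) : g.codeMem a = g.tabMem a :=
  g.codeData_of_lt_BA _ _ ha

/-- The block codes of the first list in the code memory. [folklore] -/
theorem codeMem_BA {i mb : ℕ} (hi : i < g.n) (hmb : mb < g.K) :
    g.codeMem (g.BA + i * g.K + mb) = g.codeA i mb := by
  have hK : 0 < g.K := by omega
  have hidx : i * g.K + mb < g.n * g.K := by
    calc i * g.K + mb < i * g.K + g.K := by omega
      _ = (i + 1) * g.K := by ring
      _ ≤ g.n * g.K := Nat.mul_le_mul_right _ hi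
  unfold codeMem codeData
  rw [if_pos ⟨by omega, by omega⟩, show g.BA + i * g.K + mb - g.BA = i * g.K + mb by omega]
  unfold codeVal
  rw [Nat.add_comm, Nat.add_mul_div_right _ _ hK, Nat.div_eq_of_lt hmb, Nat.zero_add, if_pos hi,
    Nat.add_mul_mod_self_right, Nat.mod_eq_of_lt hmb]

/-- The block codes of the second list in the code memory. [folklore] -/
theorem codeMem_BB {j mb : ℕ} (hj : j < g.n) (hmb : mb < g.K) :
    g.codeMem (g.BB + j * g.K + mb) = g.codeB j mb := by
  have hb := g.bases
  have hK : 0 < g.K := by omega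
  have hidx : j * g.K + mb < g.n * g.K := by
    calc j * g.K + mb < j * g.K + g.K := by omega
      _ = (j + 1) * g.K := by ring
      _ ≤ g.n * g.K := Nat.mul_le_mul_right _ hj
  unfold codeMem codeData
  rw [if_neg (by omega), if_pos ⟨by omega, by omega⟩,
    show g.BB + j * g.K + mb - g.BB = j * g.K + mb by omega]
  unfold codeVal
  rw [Nat.add_comm, Nat.add_mul_div_right _ _ hK, Nat.div_eq_of_lt hmb, Nat.zero_add, if_pos hj,
    Nat.add_mul_mod_self_right, Nat.mod_eq_of_lt hmb]

/-- The row table in the code memory. [folklore] -/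
theorem codeMem_TU {ℓ c : ℕ} (hℓ : ℓ < g.tb.r) (hc : c < g.tb.P) :
    g.codeMem (g.TU + (ℓ * g.tb.P + c)) = g.tb.U ℓ c := by
  have hb := g.bases
  have hlt : ℓ * g.tb.P + c < g.tb.r * g.tb.P :=
    calc ℓ * g.tb.P + c < ℓ * g.tb.P + g.tb.P := by omega
      _ = (ℓ + 1) * g.tb.P := by ring
      _ ≤ g.tb.r * g.tb.P := Nat.mul_le_mul_right _ hℓ
  rw [g.codeMem_of_lt_BA (by omega), g.tabMem_TU_add (by unfold Tables.tsz; omega),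
    g.tb.tableList_getD_U hℓ hc]

/-- The column table in the code memory. [folklore] -/
theorem codeMem_TV {ℓ c : ℕ} (hℓ : ℓ < g.tb.r) (hc : c < g.tb.P) :
    g.codeMem (g.TV + (ℓ * g.tb.P + c)) = g.tb.V ℓ c := by
  have hb := g.bases
  have hlt : ℓ * g.tb.P + c < g.tb.r * g.tb.P :=
    calc ℓ * g.tb.P + c < ℓ * g.tb.P + g.tb.P := by omega
      _ = (ℓ + 1) * g.tb.P := by ring
      _ ≤ g.tb.r * g.tb.P := Nat.mul_le_mul_right _ hℓ
  rw [g.codeMem_of_lt_BA (by omega), show g.TV + (ℓ * g.tb.P + c) = g.TU + (g.tb.r * g.tb.P +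
    (ℓ * g.tb.P + c)) by omega, g.tabMem_TU_add (by unfold Tables.tsz; omega),
    g.tb.tableList_getD_V hℓ hc]

/-- The magnitude table in the code memory. [folklore] -/
theorem codeMem_TC {ℓ : ℕ} (hℓ : ℓ < g.tb.r) : g.codeMem (g.TC + ℓ) = g.tb.cmag ℓ := by
  have hb := g.bases
  rw [g.codeMem_of_lt_BA (by omega), show g.TC + ℓ = g.TU + (2 * (g.tb.r * g.tb.P) + ℓ) by omega,
    g.tabMem_TU_add (by unfold Tables.tsz; omega), g.tb.tableList_getD_cmag hℓ]

/-- The sign table in the code memory. [folklore] -/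
theorem codeMem_TS {ℓ : ℕ} (hℓ : ℓ < g.tb.r) : g.codeMem (g.TS + ℓ) = g.tb.csgn ℓ := by
  have hb := g.bases
  rw [g.codeMem_of_lt_BA (by omega), show g.TS + ℓ = g.TU + (2 * (g.tb.r * g.tb.P) + g.tb.r + ℓ)
    by omega, g.tabMem_TU_add (by unfold Tables.tsz; omega), g.tb.tableList_getD_csgn hℓ]

/-- Block codes are below `2^k`. [folklore] -/
theorem codeA_lt (hk : 1 ≤ g.tb.k) (i mb : ℕ) : g.codeA i mb < g.tb.P :=
  partCode_lt (g.bitA_le i) hk _ _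

/-- Block codes are below `2^k`. [folklore] -/
theorem codeB_lt (hk : 1 ≤ g.tb.k) (j mb : ℕ) : g.codeB j mb < g.tb.P :=
  partCode_lt (g.bitB_le j) hk _ _

/-! ### The coefficient loop -/

/-- The invariant of the coefficient loop after `M` factors. [folklore] -/
structure CoefInv (m : ℕ → ℕ) (q M : ℕ) (m' : ℕ → ℕ) : Prop where
  r20 : m' 20 = g.K - M
  r21 : m' 21 = g.tb.r ^ M
  r22 : m' 22 = g.mag q M
  r23 : m' 23 = g.sgn q M
  frame : ∀ a, (a < 20 ∨ 25 < a) → m' a = m a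

/-- Powers of `cmax` that occur fit. [folklore] -/
theorem pow_cmax_lt (hF : g.Fits W) (M : ℕ) (hM : M ≤ g.K) : g.tb.cmax ^ M < 2 ^ W := by
  have hprod := hF.prod
  rcases Nat.eq_zero_or_pos g.tb.cmax with h0 | hpos
  · rw [h0]; rcases Nat.eq_zero_or_pos M with rfl | hM0
    · rw [pow_zero]; have := inputWidth_pos g.x; have := hF.width
      exact Nat.one_lt_two_pow (by omega)
    · rw [zero_pow (by omega)]; exact Nat.two_pow_pos W
  · have : g.tb.cmax ^ M ≤ g.CK := Nat.pow_le_pow_right hpos hM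
    omega

set_option maxHeartbeats 1000000 in
/-- **The coefficient loop**: `r22 := |β_q| = ∏ |α_{q_mb}|`, `r23 :=` the sign bit of `β_q`;
only the registers `20–25` change. [folklore] -/
theorem coef_spec (hF : g.Fits W) (htb : g.tb.WF) {m : ℕ → ℕ} {q : ℕ} (hq : q < g.RK)
    (r4 : m 4 = g.K) (r9 : m 9 = g.TC) (r10 : m 10 = g.TS) (r17 : m 17 = q)
    (hD : ∀ a, 100 ≤ a → a < g.KA → m a = g.codeMem a) :
    Achieves W O (coef g.tb) m (g.CoefInv m q g.K) (g.K * 10 + 5) := by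
  obtain ⟨hX, hXL, hTU, hTV, hTC, hTS, hBA, hBB, hKA, hH0, htop, hxx, hdk, hrk, hbd, hprod, hL,
    hP, hnn⟩ := g.facts hF
  have hk := htb.k_pos
  have hKd := g.K_le_d hk
  unfold coef
  refine Achieves.mono (T := 4 + (g.K * 10 + 1)) ?_ (fun _ h => h) (by omega)
  refine Achieves.seqs_cons (R := g.CoefInv m q 0) (T₁ := 4) (T₂ := g.K * 10 + 1) ?_
    fun m₁ h₁ => ?_
  · refine CliqueRed.achieves_block_of_eq (fun m' hm' => ?_) le_rfl
    simp (disch := first | omega | decide) only [execOps_cons, execOps_nil, execOp, Operand.write,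
      Operand.read, merge_apply_of_lt, update_merge_of_lt, BinOp.eval_band, Nat.and_self, r4] at hm'
    subst hm'
    refine ⟨?_, ?_, ?_, ?_, fun a ha => ?_⟩
    all_goals (try simp (disch := first | omega | decide) only [merge_apply_of_lt,
      Function.update_self, Function.update_of_ne, pow_zero, Nat.sub_zero])
    · rfl
    · rfl
    · by_cases ha' : a < 100
      · rw [merge_apply_of_lt ha']; simp (disch := omega) only [Function.update_of_ne]
      · rw [merge_apply_of_le (by omega)]
  refine Achieves.seqs_cons (T₁ := g.K * 10 + 1) (T₂ := 0) ?_ (fun _ h => Achieves.seqs_nil h)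
  refine Achieves.whilenz g.K 8 (fun M => g.CoefInv m q M) (fun M hM m' hI => ⟨?_, ?_⟩)
    (fun m' hI => ?_) h₁ (fun _ h => h) (by omega)
  · simp only [Operand.read, hI.r20]; omega
  · obtain ⟨s20, s21, s22, s23, hfr⟩ := hI
    have hr : 0 < g.tb.r := by
      rcases Nat.eq_zero_or_pos g.tb.r with h0 | h
      · exfalso; unfold RK at hq; rw [h0, zero_pow (by omega)] at hq; omega
      · exact h
    have hRK : ∀ M, M ≤ g.K → g.tb.r ^ M ≤ g.RK := fun M hM => Nat.pow_le_pow_right hr hM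
    obtain ⟨qd, hqd⟩ : ∃ qd, q / g.tb.r ^ M = qd := ⟨_, rfl⟩
    obtain ⟨ℓ, hℓ⟩ : ∃ ℓ, qd % g.tb.r = ℓ := ⟨_, rfl⟩
    have hdig : g.digit q M = ℓ := by unfold digit; rw [hqd, hℓ]
    have hℓr : ℓ < g.tb.r := by rw [← hℓ]; exact Nat.mod_lt _ hr
    have hRK1 := hRK (M + 1) (by omega)
    have hRKM := hRK M (by omega)
    have hpow1 : g.tb.r ^ M * g.tb.r < 2 ^ W := by rw [← pow_succ]; omega
    have hmag : g.mag q M * g.tb.cmag ℓ < 2 ^ W := by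
      have h1 : g.mag q M * g.tb.cmag ℓ ≤ g.tb.cmax ^ (M + 1) := by
        rw [pow_succ]; exact Nat.mul_le_mul (g.mag_le htb _ _) (htb.cmag_le _)
      exact lt_of_le_of_lt h1 (g.pow_cmax_lt hF _ (by omega))
    have hsg := g.sgn_le q M
    have hcs := htb.csgn_le ℓ
    have h2W : 2 ≤ 2 ^ W := by have := inputWidth_pos g.x; have := hF.width; have := Nat.one_lt_two_pow (n := W) (by omega); omega
    -- reads
    have e17 : m' 17 = q := by rw [hfr 17 (by omega), r17]
    have e9 : m' 9 = g.TC := by rw [hfr 9 (by omega), r9]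
    have e10 : m' 10 = g.TS := by rw [hfr 10 (by omega), r10]
    have emag : m' (g.TC + ℓ) = g.tb.cmag ℓ := by
      rw [hfr _ (by omega), hD _ (by omega) (by omega), g.codeMem_TC hℓr]
    have esgn : m' (g.TS + ℓ) = g.tb.csgn ℓ := by
      rw [hfr _ (by omega), hD _ (by omega) (by omega), g.codeMem_TS hℓr]
    refine CliqueRed.achieves_block_of_eq (fun m'' hm'' => ?_) le_rfl
    simp (disch := first | omega | decide) only [execOps_cons, execOps_nil, execOp,
      Operand.write, Operand.read, merge_apply_of_lt, merge_apply_of_le, update_merge_of_lt,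
      Function.update_self, Function.update_of_ne, BinOp.eval_add_of_lt,
      BinOp.eval_sub_of_le, BinOp.eval_div, BinOp.eval_mod, BinOp.eval_mul_of_lt,
      BinOp.eval_bxor_of_lt, s20, s21, s22, s23, e17, e9, e10, hqd, hℓ, emag, esgn] at hm''
    subst hm''
    refine ⟨?_, ?_, ?_, ?_, fun a ha => ?fr⟩
    case fr =>
      by_cases ha' : a < 100
      · rw [merge_apply_of_lt ha']; simp (disch := omega) only [Function.update_of_ne]
        exact hfr a ha
      · rw [merge_apply_of_le (by omega)]; exact hfr a ha
    all_goals (try simp (disch := first | omega | decide) only [merge_apply_of_lt,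
      Function.update_self, Function.update_of_ne])
    · omega
    · rw [pow_succ]
    · rw [g.mag_succ, hdig]
    · rw [g.sgn_succ htb, hdig]
  · simp only [Operand.read, hI.r20]; omega


/-! ### The insert loop -/

/-- The invariant of the insert loop after `p` rows: the keys of the rows `< p` at `KA`, their
counts in the counting array. [folklore] -/
structure InsInv (m : ℕ → ℕ) (q p : ℕ) (m' : ℕ → ℕ) : Prop where
  frame : ∀ a, a < 30 → a ≠ 20 → a ≠ 26 → a ≠ 27 → m' a = m a
  r20 : m' 20 = g.n - p
  r26 : m' 26 = g.BA + p * g.K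
  r27 : m' 27 = g.KA + p
  low : ∀ a, 100 ≤ a → a < g.KA → m' a = g.codeMem a
  keys : ∀ i, i < p → m' (g.KA + i) = g.keyA q i g.K
  hash : ∀ a, g.H0 ≤ a → m' a = g.hcount q p (a - g.H0)

set_option maxHeartbeats 1000000 in
/-- **The insert loop**: the keys of all rows of the first list are stored at `KA` and counted
in the counting array (`H0 + v ↦ #{i : key_i = v}`). [folklore] -/
theorem insert_spec (hF : g.Fits W) (htb : g.tb.WF) {m : ℕ → ℕ} {q : ℕ} (hq : q < g.RK)
    (r2 : m 2 = g.n) (r4 : m 4 = g.K) (r5 : m 5 = g.BA) (r7 : m 7 = g.TU) (r11 : m 11 = g.KA)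
    (r12 : m 12 = g.H0) (r17 : m 17 = q)
    (hlow : ∀ a, 100 ≤ a → a < g.KA → m a = g.codeMem a) (hhash : ∀ a, g.H0 ≤ a → m a = 0) :
    Achieves W O (insert g.tb) m (g.InsInv m q g.n) (g.n * (g.K * 14 + 14) + 4) := by
  obtain ⟨hX, hXL, hTU, hTV, hTC, hTS, hBA, hBB, hKA, hH0, htop, hxx, hdk, hrk, hbd, hprod, hL,
    hP, hnn⟩ := g.facts hF
  have hk := htb.k_pos
  unfold insert
  refine Achieves.mono (T := 3 + (g.n * (g.K * 14 + 14) + 1)) ?_ (fun _ h => h) (by omega)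
  refine Achieves.seqs_cons (R := g.InsInv m q 0) (T₁ := 3) (T₂ := g.n * (g.K * 14 + 14) + 1) ?_
    fun m₁ h₁ => ?_
  · refine CliqueRed.achieves_block_of_eq (fun m' hm' => ?_) le_rfl
    simp (disch := first | omega | decide) only [execOps_cons, execOps_nil, execOp, Operand.write,
      Operand.read, merge_apply_of_lt, update_merge_of_lt, Function.update_of_ne,
      BinOp.eval_band, Nat.and_self, r2, r5, r11] at hm'
    subst hm'
    refine ⟨fun a ha h1 h2 h3 => ?_, ?_, ?_, ?_, fun a ha ha' => ?_, fun i hi => absurd hi (Nat.not_lt_zero _),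
      fun a ha => ?_⟩
    all_goals (try simp (disch := first | omega | decide) only [merge_apply_of_lt,
      merge_apply_of_le, Function.update_self, Function.update_of_ne, Nat.zero_mul, Nat.add_zero,
      Nat.sub_zero])
    · exact hlow a ha ha'
    · rw [hhash a ha, g.hcount_zero]
  refine Achieves.seqs_cons (T₁ := g.n * (g.K * 14 + 14) + 1) (T₂ := 0) ?_
    (fun _ h => Achieves.seqs_nil h)
  refine Achieves.whilenz g.n (g.K * 14 + 12) (fun p => g.InsInv m q p) (fun p hp m' hI => ⟨?_, ?_⟩)
    (fun m' hI => ?_) h₁ (fun _ h => h) (by rw [show g.K * 14 + 12 + 2 = g.K * 14 + 14 from rfl])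
  · simp only [Operand.read, hI.r20]; omega
  · obtain ⟨hfr, s20, s26, s27, slow, skeys, shash⟩ := hI
    have hpK : (p + 1) * g.K ≤ g.n * g.K := Nat.mul_le_mul_right _ hp
    have hpK' : (p + 1) * g.K = p * g.K + g.K := by ring
    unfold insBody
    refine Achieves.mono (T := (g.K * 14 + 6) + 6) ?_ (fun _ h => h) (by omega)
    refine Achieves.seqs_cons (R := g.KeyInv m' q (g.BA + p * g.K) g.tb.U (g.codeA p) g.K)
      (T₁ := g.K * 14 + 6) (T₂ := 6) ?_ fun m₂ h₂ => ?_
    · exact g.keyLoop_spec hF htb (Or.inl rfl) g.tb.U (g.codeA p) hq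
        (by rw [hfr 4 (by omega) (by omega) (by omega) (by omega), r4])
        (by rw [hfr 17 (by omega) (by omega) (by omega) (by omega), r17]) s26
        (by rw [hfr 7 (by omega) (by omega) (by omega) (by omega), r7]) (by omega) (by omega)
        (by omega) (by omega)
        (fun mb hmb => by rw [slow _ (by omega) (by omega), g.codeMem_BA hp hmb])
        (fun mb => g.codeA_lt hk p mb)
        (fun ℓ c hℓ hc => by
          have hlt : ℓ * g.tb.P + c < g.tb.r * g.tb.P :=
            calc ℓ * g.tb.P + c < ℓ * g.tb.P + g.tb.P := by omega
              _ = (ℓ + 1) * g.tb.P := by ring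
              _ ≤ g.tb.r * g.tb.P := Nat.mul_le_mul_right _ hℓ
          rw [slow _ (by omega) (by omega), g.codeMem_TU hℓ hc])
        (fun ℓ c => htb.U_lt ℓ c)
    obtain ⟨t30, t31, t32, t33, t34, tfr⟩ := h₂
    refine Achieves.seqs_cons (T₁ := 6) (T₂ := 0) ?_ (fun _ h => Achieves.seqs_nil h)
    have hkey : m₂ 33 = g.keyA q p g.K := t33
    have hkeylt : g.keyA q p g.K < g.BK := g.keyA_lt htb q p g.K
    have e27 : m₂ 27 = g.KA + p := by rw [tfr 27 (by omega), s27]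
    have e12 : m₂ 12 = g.H0 := by
      rw [tfr 12 (by omega), hfr 12 (by omega) (by omega) (by omega) (by omega), r12]
    have e20 : m₂ 20 = g.n - p := by rw [tfr 20 (by omega), s20]
    have ehash : m₂ (g.H0 + g.keyA q p g.K) = g.hcount q p (g.keyA q p g.K) := by
      rw [tfr _ (by omega), shash _ (by omega), Nat.add_sub_cancel_left]
    have hcnt : g.hcount q p (g.keyA q p g.K) + 1 < 2 ^ W := by
      have := g.hcount_le q p (g.keyA q p g.K); omega
    have hne : g.KA + p ≠ g.H0 + g.keyA q p g.K := by omega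
    refine CliqueRed.achieves_block_of_eq (fun m'' hm'' => ?_) le_rfl
    simp (disch := first | omega | decide) only [execOps_cons, execOps_nil, execOp,
      Operand.write, Operand.read, merge_apply_of_lt, merge_apply_of_le, update_merge_of_lt,
      update_merge_of_le, Function.update_self, Function.update_of_ne, BinOp.eval_add_of_lt,
      BinOp.eval_sub_of_le, BinOp.eval_band, Nat.and_self, hkey, e27, e12, e20, t34, ehash]
      at hm''
    subst hm''
    refine ⟨fun a ha h1 h2 h3 => ?fr, ?_, ?_, ?_, fun a ha ha' => ?low, fun i hi => ?keys,
      fun a ha => ?hash⟩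
    case fr =>
      rw [merge_apply_of_lt (by omega)]
      simp (disch := omega) only [Function.update_of_ne]
      rw [tfr a (by omega), hfr a ha h1 h2 h3]
    case low =>
      rw [merge_apply_of_le ha]
      simp (disch := omega) only [Function.update_of_ne]
      rw [tfr a (by omega), slow a ha ha']
    case keys =>
      rw [merge_apply_of_le (by omega)]
      rcases Nat.lt_succ_iff_lt_or_eq.1 hi with hi' | rfl
      · simp (disch := omega) only [Function.update_of_ne]
        rw [tfr _ (by omega), skeys i hi']
      · simp (disch := omega) only [Function.update_of_ne, Function.update_self]
    case hash =>
      rw [merge_apply_of_le (by omega), g.hcount_succ]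
      by_cases hav : a = g.H0 + g.keyA q p g.K
      · subst hav
        rw [Function.update_self, Nat.add_sub_cancel_left, if_pos rfl]
      · rw [Function.update_of_ne hav, Function.update_of_ne (by omega), tfr a (by omega),
          shash a ha, if_neg (by omega), Nat.add_zero]
    all_goals (try simp (disch := first | omega | decide) only [merge_apply_of_lt,
      Function.update_self, Function.update_of_ne])
    all_goals omega
  · simp only [Operand.read, hI.r20]; omega


/-! ### The count loop -/

/-- The invariant of the count loop after `p` rows of the second list. [folklore] -/
structure CntInv (m : ℕ → ℕ) (q p : ℕ) (m' : ℕ → ℕ) : Prop where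
  frame : ∀ a, a < 30 → a ≠ 20 → a ≠ 26 → a ≠ 28 → m' a = m a
  r20 : m' 20 = g.n - p
  r26 : m' 26 = g.BB + p * g.K
  r28 : m' 28 = g.cnt q p
  data : ∀ a, 100 ≤ a → m' a = m a

set_option maxHeartbeats 1000000 in
/-- **The count loop**: `r28 := Σ_j #{i : key_i = key'_j}`, the number of equal key pairs; the
data is unchanged. [folklore] -/
theorem count_spec (hF : g.Fits W) (htb : g.tb.WF) {m : ℕ → ℕ} {q : ℕ} (hq : q < g.RK)
    (r2 : m 2 = g.n) (r4 : m 4 = g.K) (r6 : m 6 = g.BB) (r8 : m 8 = g.TV) (r12 : m 12 = g.H0)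
    (r17 : m 17 = q)
    (hlow : ∀ a, 100 ≤ a → a < g.KA → m a = g.codeMem a)
    (hhash : ∀ a, g.H0 ≤ a → m a = g.hcount q g.n (a - g.H0)) :
    Achieves W O (count g.tb) m (g.CntInv m q g.n) (g.n * (g.K * 14 + 12) + 4) := by
  obtain ⟨hX, hXL, hTU, hTV, hTC, hTS, hBA, hBB, hKA, hH0, htop, hxx, hdk, hrk, hbd, hprod, hL,
    hP, hnn⟩ := g.facts hF
  have hk := htb.k_pos
  unfold count
  refine Achieves.mono (T := 3 + (g.n * (g.K * 14 + 12) + 1)) ?_ (fun _ h => h) (by omega)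
  refine Achieves.seqs_cons (R := g.CntInv m q 0) (T₁ := 3) (T₂ := g.n * (g.K * 14 + 12) + 1) ?_
    fun m₁ h₁ => ?_
  · refine CliqueRed.achieves_block_of_eq (fun m' hm' => ?_) le_rfl
    simp (disch := first | omega | decide) only [execOps_cons, execOps_nil, execOp, Operand.write,
      Operand.read, merge_apply_of_lt, update_merge_of_lt, Function.update_of_ne,
      BinOp.eval_band, Nat.and_self, r2, r6] at hm'
    subst hm'
    refine ⟨fun a ha h1 h2 h3 => ?_, ?_, ?_, ?_, fun a ha => ?_⟩
    all_goals (try simp (disch := first | omega | decide) only [merge_apply_of_lt,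
      merge_apply_of_le, Function.update_self, Function.update_of_ne, Nat.zero_mul, Nat.add_zero,
      Nat.sub_zero, g.cnt_zero])
  refine Achieves.seqs_cons (T₁ := g.n * (g.K * 14 + 12) + 1) (T₂ := 0) ?_
    (fun _ h => Achieves.seqs_nil h)
  refine Achieves.whilenz g.n (g.K * 14 + 10) (fun p => g.CntInv m q p) (fun p hp m' hI => ⟨?_, ?_⟩)
    (fun m' hI => ?_) h₁ (fun _ h => h) (by rw [show g.K * 14 + 10 + 2 = g.K * 14 + 12 from rfl])
  · simp only [Operand.read, hI.r20]; omega
  · obtain ⟨hfr, s20, s26, s28, sD⟩ := hI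
    have hpK : (p + 1) * g.K ≤ g.n * g.K := Nat.mul_le_mul_right _ hp
    have hpK' : (p + 1) * g.K = p * g.K + g.K := by ring
    unfold cntBody
    refine Achieves.mono (T := (g.K * 14 + 6) + 4) ?_ (fun _ h => h) (by omega)
    refine Achieves.seqs_cons (R := g.KeyInv m' q (g.BB + p * g.K) g.tb.V (g.codeB p) g.K)
      (T₁ := g.K * 14 + 6) (T₂ := 4) ?_ fun m₂ h₂ => ?_
    · exact g.keyLoop_spec hF htb (Or.inr rfl) g.tb.V (g.codeB p) hq
        (by rw [hfr 4 (by omega) (by omega) (by omega) (by omega), r4])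
        (by rw [hfr 17 (by omega) (by omega) (by omega) (by omega), r17]) s26
        (by rw [hfr 8 (by omega) (by omega) (by omega) (by omega), r8]) (by omega) (by omega)
        (by omega) (by omega)
        (fun mb hmb => by rw [sD _ (by omega), hlow _ (by omega) (by omega), g.codeMem_BB hp hmb])
        (fun mb => g.codeB_lt hk p mb)
        (fun ℓ c hℓ hc => by
          have hlt : ℓ * g.tb.P + c < g.tb.r * g.tb.P :=
            calc ℓ * g.tb.P + c < ℓ * g.tb.P + g.tb.P := by omega
              _ = (ℓ + 1) * g.tb.P := by ring
              _ ≤ g.tb.r * g.tb.P := Nat.mul_le_mul_right _ hℓ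
          rw [sD _ (by omega), hlow _ (by omega) (by omega), g.codeMem_TV hℓ hc])
        (fun ℓ c => htb.V_lt ℓ c)
    obtain ⟨t30, t31, t32, t33, t34, tfr⟩ := h₂
    refine Achieves.seqs_cons (T₁ := 4) (T₂ := 0) ?_ (fun _ h => Achieves.seqs_nil h)
    have hkey : m₂ 33 = g.keyB q p g.K := t33
    have hkeylt : g.keyB q p g.K < g.BK := g.keyB_lt htb q p g.K
    have e12 : m₂ 12 = g.H0 := by
      rw [tfr 12 (by omega), hfr 12 (by omega) (by omega) (by omega) (by omega), r12]
    have e20 : m₂ 20 = g.n - p := by rw [tfr 20 (by omega), s20]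
    have e28 : m₂ 28 = g.cnt q p := by rw [tfr 28 (by omega), s28]
    have ehash : m₂ (g.H0 + g.keyB q p g.K) = g.hcount q g.n (g.keyB q p g.K) := by
      rw [tfr _ (by omega), sD _ (by omega), hhash _ (by omega), Nat.add_sub_cancel_left]
    have hcnt : g.cnt q p + g.hcount q g.n (g.keyB q p g.K) < 2 ^ W := by
      rw [← g.cnt_succ]
      have h1 := g.cnt_le q (p + 1)
      have h2 : (p + 1) * g.n ≤ g.n * g.n := Nat.mul_le_mul_right _ hp
      omega
    refine CliqueRed.achieves_block_of_eq (fun m'' hm'' => ?_) le_rfl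
    simp (disch := first | omega | decide) only [execOps_cons, execOps_nil, execOp,
      Operand.write, Operand.read, merge_apply_of_lt, merge_apply_of_le, update_merge_of_lt,
      Function.update_self, Function.update_of_ne, BinOp.eval_add_of_lt,
      BinOp.eval_sub_of_le, BinOp.eval_band, Nat.and_self, hkey, e12, e20, e28, t34, ehash]
      at hm''
    subst hm''
    refine ⟨fun a ha h1 h2 h3 => ?fr, ?_, ?_, ?_, fun a ha => ?data⟩
    case fr =>
      rw [merge_apply_of_lt (by omega)]
      simp (disch := omega) only [Function.update_of_ne]
      rw [tfr a (by omega), hfr a ha h1 h2 h3]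
    case data =>
      rw [merge_apply_of_le ha, tfr a (by omega), sD a ha]
    all_goals (try simp (disch := first | omega | decide) only [merge_apply_of_lt,
      Function.update_self, Function.update_of_ne])
    · omega
    · omega
    · rw [g.cnt_succ]
  · simp only [Operand.read, hI.r20]; omega


/-! ### The reset loop -/

/-- The counting array during the reset loop: the entries at the keys of the rows `< p` are
already cleared. [folklore] -/
def rstVal (q p v : ℕ) : ℕ := if g.hcount q p v = 0 then g.hcount q g.n v else 0

/-- Before the reset the array holds the counts. [folklore] -/
theorem rstVal_zero (q v : ℕ) : g.rstVal q 0 v = g.hcount q g.n v := by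
  unfold rstVal; rw [g.hcount_zero, if_pos rfl]

/-- After the reset the array is zero. [folklore] -/
theorem rstVal_n (q v : ℕ) : g.rstVal q g.n v = 0 := by
  unfold rstVal; split_ifs with h <;> first | exact h | rfl

/-- One more key cleared. [folklore] -/
theorem rstVal_succ (q p v : ℕ) :
    g.rstVal q (p + 1) v = if g.keyA q p g.K = v then 0 else g.rstVal q p v := by
  unfold rstVal; rw [g.hcount_succ]
  by_cases h : g.keyA q p g.K = v
  · rw [if_pos h, if_pos h, if_neg (by omega)]
  · rw [if_neg h, if_neg h, Nat.add_zero]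

/-- The invariant of the reset loop after `p` rows. [folklore] -/
structure RstInv (m : ℕ → ℕ) (q p : ℕ) (m' : ℕ → ℕ) : Prop where
  frame : ∀ a, a < 30 → a ≠ 20 → a ≠ 27 → m' a = m a
  r20 : m' 20 = g.n - p
  r27 : m' 27 = g.KA + p
  data : ∀ a, 100 ≤ a → a < g.H0 → m' a = m a
  hash : ∀ a, g.H0 ≤ a → m' a = g.rstVal q p (a - g.H0)

set_option maxHeartbeats 1000000 in
/-- **The reset loop**: the counting array is cleared at every stored key, hence returns to zero;
nothing else in the data changes. [folklore] -/
theorem reset_spec (hF : g.Fits W) (htb : g.tb.WF) {m : ℕ → ℕ} {q : ℕ}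
    (r2 : m 2 = g.n) (r11 : m 11 = g.KA) (r12 : m 12 = g.H0)
    (hkeys : ∀ i, i < g.n → m (g.KA + i) = g.keyA q i g.K)
    (hhash : ∀ a, g.H0 ≤ a → m a = g.hcount q g.n (a - g.H0)) :
    Achieves W O reset m (g.RstInv m q g.n) (g.n * 6 + 3) := by
  obtain ⟨hX, hXL, hTU, hTV, hTC, hTS, hBA, hBB, hKA, hH0, htop, hxx, hdk, hrk, hbd, hprod, hL,
    hP, hnn⟩ := g.facts hF
  unfold reset
  refine Achieves.mono (T := 2 + (g.n * 6 + 1)) ?_ (fun _ h => h) (by omega)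
  refine Achieves.seqs_cons (R := g.RstInv m q 0) (T₁ := 2) (T₂ := g.n * 6 + 1) ?_ fun m₁ h₁ => ?_
  · refine CliqueRed.achieves_block_of_eq (fun m' hm' => ?_) le_rfl
    simp (disch := first | omega | decide) only [execOps_cons, execOps_nil, execOp, Operand.write,
      Operand.read, merge_apply_of_lt, update_merge_of_lt, Function.update_of_ne,
      BinOp.eval_band, Nat.and_self, r2, r11] at hm'
    subst hm'
    refine ⟨fun a ha h1 h2 => ?_, ?_, ?_, fun a ha _ => ?_, fun a ha => ?_⟩
    all_goals (try simp (disch := first | omega | decide) only [merge_apply_of_lt,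
      merge_apply_of_le, Function.update_self, Function.update_of_ne, Nat.add_zero, Nat.sub_zero])
    rw [g.rstVal_zero, hhash a ha]
  refine Achieves.seqs_cons (T₁ := g.n * 6 + 1) (T₂ := 0) ?_ (fun _ h => Achieves.seqs_nil h)
  refine Achieves.whilenz g.n 4 (fun p => g.RstInv m q p) (fun p hp m' hI => ⟨?_, ?_⟩)
    (fun m' hI => ?_) h₁ (fun _ h => h) (by omega)
  · simp only [Operand.read, hI.r20]; omega
  · obtain ⟨hfr, s20, s27, sD, shash⟩ := hI
    have hkeylt : g.keyA q p g.K < g.BK := g.keyA_lt htb q p g.K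
    have e12 : m' 12 = g.H0 := by rw [hfr 12 (by omega) (by omega) (by omega), r12]
    have ekey : m' (g.KA + p) = g.keyA q p g.K := by rw [sD _ (by omega) (by omega), hkeys p hp]
    refine CliqueRed.achieves_block_of_eq (fun m'' hm'' => ?_) le_rfl
    simp (disch := first | omega | decide) only [execOps_cons, execOps_nil, execOp,
      Operand.write, Operand.read, merge_apply_of_lt, merge_apply_of_le, update_merge_of_lt,
      update_merge_of_le, Function.update_self, Function.update_of_ne, BinOp.eval_add_of_lt,
      BinOp.eval_sub_of_le, BinOp.eval_band, Nat.and_self, s20, s27, e12, ekey] at hm''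
    subst hm''
    refine ⟨fun a ha h1 h2 => ?fr, ?_, ?_, fun a ha ha' => ?data, fun a ha => ?hash⟩
    case fr =>
      rw [merge_apply_of_lt (by omega)]
      simp (disch := omega) only [Function.update_of_ne]
      exact hfr a ha h1 h2
    case data =>
      rw [merge_apply_of_le ha, Function.update_of_ne (by omega), sD a ha ha']
    case hash =>
      rw [merge_apply_of_le (by omega), g.rstVal_succ]
      by_cases hav : a = g.H0 + g.keyA q p g.K
      · subst hav; rw [Function.update_self, Nat.add_sub_cancel_left, if_pos rfl]
      · rw [Function.update_of_ne hav, shash a ha, if_neg (by omega)]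
    all_goals (try simp (disch := first | omega | decide) only [merge_apply_of_lt,
      Function.update_self, Function.update_of_ne])
    all_goals omega
  · simp only [Operand.read, hI.r20]; omega

/-! ### Accumulation -/

/-- The accumulated sums stay below the word size. [folklore] -/
theorem accum_bound (hF : g.Fits W) (htb : g.tb.WF) {q : ℕ} (hq : q < g.RK) (S : ℕ)
    (hS : S ≤ q * (g.CK * (g.n * g.n))) : S + g.mag q g.K * g.cnt q g.n < 2 ^ W := by
  have hprod := hF.prod
  have h1 : g.mag q g.K * g.cnt q g.n ≤ g.CK * (g.n * g.n) :=
    Nat.mul_le_mul (g.mag_le htb _ _) (g.cnt_le _ _)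
  have h2 : S + g.mag q g.K * g.cnt q g.n ≤ (q + 1) * (g.CK * (g.n * g.n)) := by
    rw [Nat.succ_mul]; omega
  have h3 : (q + 1) * (g.CK * (g.n * g.n)) ≤ g.RK * (g.CK * (g.n * g.n)) :=
    Nat.mul_le_mul_right _ hq
  have h4 : g.RK * (g.CK * (g.n * g.n)) ≤ g.RK * g.CK * (g.n * g.n + 1) := by
    rw [Nat.mul_assoc]; exact Nat.mul_le_mul_left _ (Nat.mul_le_mul_left _ (Nat.le_succ _))
  omega

/-- The product `|β_q| · count` stays below the word size. [folklore] -/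
theorem mag_mul_cnt_lt (hF : g.Fits W) (htb : g.tb.WF) {q : ℕ} (hq : q < g.RK) :
    g.mag q g.K * g.cnt q g.n < 2 ^ W := by
  have := g.accum_bound hF htb hq 0 (Nat.zero_le _); omega

/-- **Accumulation**: `S⁺` or `S⁻` (by the sign bit `r23`) grows by `|β_q| · count`. [folklore] -/
theorem accum_spec (hF : g.Fits W) (htb : g.tb.WF) {m : ℕ → ℕ} {q : ℕ} (hq : q < g.RK)
    (r15 : m 15 = g.Spos q) (r16 : m 16 = g.Sneg q) (r22 : m 22 = g.mag q g.K)
    (r23 : m 23 = g.sgn q g.K) (r28 : m 28 = g.cnt q g.n) :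
    Achieves W O accum m
      (fun m' => m' 15 = g.Spos (q + 1) ∧ m' 16 = g.Sneg (q + 1) ∧
        ∀ a, a ≠ 15 → a ≠ 16 → a ≠ 24 → m' a = m a) 4 := by
  have hmc := g.mag_mul_cnt_lt hF htb hq
  have hSp := g.accum_bound hF htb hq _ (g.Spos_le htb q)
  have hSn := g.accum_bound hF htb hq _ (g.Sneg_le htb q)
  have hsg := g.sgn_le q g.K
  unfold accum
  refine Achieves.seqs_cons (R := fun m₁ => m₁ 24 = g.mag q g.K * g.cnt q g.n ∧
      ∀ a, a ≠ 24 → m₁ a = m a) (T₁ := 1) (T₂ := 3) ?_ fun m₁ ⟨h24, hfr⟩ => ?_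
  · refine CliqueRed.achieves_block_of_eq (fun m' hm' => ?_) le_rfl
    simp (disch := first | omega | decide) only [execOps_cons, execOps_nil, execOp, Operand.write,
      Operand.read, merge_apply_of_lt, update_merge_of_lt, BinOp.eval_mul_of_lt, r22, r28] at hm'
    subst hm'
    refine ⟨by simp (disch := first | omega | decide) only [merge_apply_of_lt, Function.update_self],
      fun a ha => ?_⟩
    by_cases ha' : a < 100
    · rw [merge_apply_of_lt ha', Function.update_of_ne ha]
    · rw [merge_apply_of_le (by omega)]
  refine Achieves.seqs_cons (T₁ := 3) (T₂ := 0) ?_ (fun _ h => Achieves.seqs_nil h)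
  have e15 : m₁ 15 = g.Spos q := by rw [hfr 15 (by omega), r15]
  have e16 : m₁ 16 = g.Sneg q := by rw [hfr 16 (by omega), r16]
  have e23 : m₁ 23 = g.sgn q g.K := by rw [hfr 23 (by omega), r23]
  refine Achieves.ifz (fun h0 => ?_) (fun h1 => ?_)
  · simp only [Operand.read, e23] at h0
    refine CliqueRed.achieves_block_of_eq (fun m' hm' => ?_) le_rfl
    simp (disch := first | omega | decide) only [execOps_cons, execOps_nil, execOp, Operand.write,
      Operand.read, merge_apply_of_lt, update_merge_of_lt, BinOp.eval_add_of_lt, e15, h24] at hm'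
    subst hm'
    refine ⟨?_, ?_, fun a h1 h2 h3 => ?_⟩
    · simp (disch := first | omega | decide) only [merge_apply_of_lt, Function.update_self]
      rw [g.Spos_succ, if_pos h0]
    · simp (disch := first | omega | decide) only [merge_apply_of_lt, Function.update_of_ne]
      rw [e16, g.Sneg_succ, if_neg (by rw [h0]; decide), Nat.add_zero]
    · by_cases ha' : a < 100
      · rw [merge_apply_of_lt ha', Function.update_of_ne h1, hfr a h3]
      · rw [merge_apply_of_le (by omega), hfr a h3]
  · simp only [Operand.read, e23] at h1
    refine CliqueRed.achieves_block_of_eq (fun m' hm' => ?_) le_rfl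
    simp (disch := first | omega | decide) only [execOps_cons, execOps_nil, execOp, Operand.write,
      Operand.read, merge_apply_of_lt, update_merge_of_lt, BinOp.eval_add_of_lt, e16, h24] at hm'
    subst hm'
    refine ⟨?_, ?_, fun a h1' h2 h3 => ?_⟩
    · simp (disch := first | omega | decide) only [merge_apply_of_lt, Function.update_of_ne]
      rw [e15, g.Spos_succ, if_neg h1, Nat.add_zero]
    · simp (disch := first | omega | decide) only [merge_apply_of_lt, Function.update_self]
      rw [g.Sneg_succ, if_pos h1]
    · by_cases ha' : a < 100
      · rw [merge_apply_of_lt ha', Function.update_of_ne h2, hfr a h3]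
      · rw [merge_apply_of_le (by omega), hfr a h3]


/-! ### One term, and the main loop -/

/-- The invariant of the main loop after `q` terms: registers `< 14` frozen, the counters and sums,
the data outside the key array (codes and tables below `KA`, zero counting array). [folklore] -/
structure MainInv (m₀ : ℕ → ℕ) (q : ℕ) (m : ℕ → ℕ) : Prop where
  frame : ∀ a, a < 14 → m a = m₀ a
  r14 : m 14 = g.RK - q
  r15 : m 15 = g.Spos q
  r16 : m 16 = g.Sneg q
  r17 : m 17 = q
  low : ∀ a, 100 ≤ a → a < g.KA → m a = g.codeMem a
  hash : ∀ a, g.H0 ≤ a → m a = 0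

/-- The time of one term. [folklore] -/
def Tq : ℕ := g.K * 10 + g.n * (g.K * 28 + 32) + 22

set_option maxHeartbeats 4000000 in
/-- **One term `q`**: coefficient, insert, count, reset, accumulate, advance. [folklore] -/
theorem qBody_spec (hF : g.Fits W) (htb : g.tb.WF) {m₀ : ℕ → ℕ} (hR : g.Regs m₀)
    {q : ℕ} (hq : q < g.RK) {m : ℕ → ℕ} (hI : g.MainInv m₀ q m) :
    Achieves W O (qBody g.tb) m (g.MainInv m₀ (q + 1)) g.Tq := by
  obtain ⟨hX, hXL, hTU, hTV, hTC, hTS, hBA, hBB, hKA, hH0, htop, hxx, hdk, hrk, hbd, hprod, hL,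
    hP, hnn⟩ := g.facts hF
  obtain ⟨r0, r2, r3, r4, r5, r6, r7, r8, r9, r10, r11, r12⟩ := hR
  obtain ⟨hfr, s14, s15, s16, s17, slow, shash⟩ := hI
  have reg : ∀ a, a < 14 → ∀ v, m₀ a = v → m a = v := fun a ha v hv => by rw [hfr a ha, hv]
  unfold qBody Tq
  refine Achieves.mono (T := (g.K * 10 + 5) + ((g.n * (g.K * 14 + 14) + 4) +
    ((g.n * (g.K * 14 + 12) + 4) + ((g.n * 6 + 3) + (4 + 2))))) ?_ (fun _ h => h) (by
      have : g.n * (g.K * 28 + 32) = g.n * (g.K * 14 + 14) + g.n * (g.K * 14 + 12) + g.n * 6 := by ring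
      omega)
  -- coefficient
  refine Achieves.seqs_cons (R := g.CoefInv m q g.K) (T₁ := g.K * 10 + 5) ?_ fun m₁ h₁ => ?_
  · exact g.coef_spec hF htb hq (reg 4 (by omega) _ r4) (reg 9 (by omega) _ r9)
      (reg 10 (by omega) _ r10) s17 slow
  obtain ⟨_, _, c22, c23, cfr⟩ := h₁
  have reg1 : ∀ a, a < 14 → ∀ v, m₀ a = v → m₁ a = v := fun a ha v hv => by
    rw [cfr a (by omega), hfr a ha, hv]
  -- insert
  refine Achieves.seqs_cons (R := g.InsInv m₁ q g.n) (T₁ := g.n * (g.K * 14 + 14) + 4) ?_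
    fun m₂ h₂ => ?_
  · exact g.insert_spec hF htb hq (reg1 2 (by omega) _ r2) (reg1 4 (by omega) _ r4)
      (reg1 5 (by omega) _ r5) (reg1 7 (by omega) _ r7) (reg1 11 (by omega) _ r11)
      (reg1 12 (by omega) _ r12) (by rw [cfr 17 (by omega), s17])
      (fun a ha ha' => by rw [cfr a (by omega), slow a ha ha'])
      (fun a ha => by rw [cfr a (by omega), shash a ha])
  obtain ⟨ifr, _, _, _, ilow, ikeys, ihash⟩ := h₂
  have reg2 : ∀ a, a < 14 → ∀ v, m₀ a = v → m₂ a = v := fun a ha v hv => by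
    rw [ifr a (by omega) (by omega) (by omega) (by omega)]; exact reg1 a ha v hv
  -- count
  refine Achieves.seqs_cons (R := g.CntInv m₂ q g.n) (T₁ := g.n * (g.K * 14 + 12) + 4) ?_
    fun m₃ h₃ => ?_
  · exact g.count_spec hF htb hq (reg2 2 (by omega) _ r2) (reg2 4 (by omega) _ r4)
      (reg2 6 (by omega) _ r6) (reg2 8 (by omega) _ r8) (reg2 12 (by omega) _ r12)
      (by rw [ifr 17 (by omega) (by omega) (by omega) (by omega), cfr 17 (by omega), s17]) ilow ihash
  obtain ⟨tfr, _, _, t28, tD⟩ := h₃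
  have reg3 : ∀ a, a < 14 → ∀ v, m₀ a = v → m₃ a = v := fun a ha v hv => by
    rw [tfr a (by omega) (by omega) (by omega) (by omega)]; exact reg2 a ha v hv
  -- reset
  refine Achieves.seqs_cons (R := g.RstInv m₃ q g.n) (T₁ := g.n * 6 + 3) ?_ fun m₄ h₄ => ?_
  · exact g.reset_spec hF htb (reg3 2 (by omega) _ r2) (reg3 11 (by omega) _ r11)
      (reg3 12 (by omega) _ r12) (fun i hi => by rw [tD _ (by omega), ikeys i hi])
      (fun a ha => by rw [tD _ (by omega), ihash a ha])
  obtain ⟨ufr, _, _, uD, uhash⟩ := h₄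
  have reg4 : ∀ a, a < 14 → ∀ v, m₀ a = v → m₄ a = v := fun a ha v hv => by
    rw [ufr a (by omega) (by omega) (by omega)]; exact reg3 a ha v hv
  -- accumulate
  have e15 : m₄ 15 = g.Spos q := by
    rw [ufr 15 (by omega) (by omega) (by omega), tfr 15 (by omega) (by omega) (by omega) (by omega),
      ifr 15 (by omega) (by omega) (by omega) (by omega), cfr 15 (by omega), s15]
  have e16 : m₄ 16 = g.Sneg q := by
    rw [ufr 16 (by omega) (by omega) (by omega), tfr 16 (by omega) (by omega) (by omega) (by omega),
      ifr 16 (by omega) (by omega) (by omega) (by omega), cfr 16 (by omega), s16]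
  have e22 : m₄ 22 = g.mag q g.K := by
    rw [ufr 22 (by omega) (by omega) (by omega), tfr 22 (by omega) (by omega) (by omega) (by omega),
      ifr 22 (by omega) (by omega) (by omega) (by omega), c22]
  have e23 : m₄ 23 = g.sgn q g.K := by
    rw [ufr 23 (by omega) (by omega) (by omega), tfr 23 (by omega) (by omega) (by omega) (by omega),
      ifr 23 (by omega) (by omega) (by omega) (by omega), c23]
  have e28 : m₄ 28 = g.cnt q g.n := by rw [ufr 28 (by omega) (by omega) (by omega), t28]
  refine Achieves.seqs_cons (T₁ := 4) (T₂ := 2) (g.accum_spec hF htb hq e15 e16 e22 e23 e28)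
    fun m₅ ⟨v15, v16, vfr⟩ => ?_
  have reg5 : ∀ a, a < 14 → ∀ v, m₀ a = v → m₅ a = v := fun a ha v hv => by
    rw [vfr a (by omega) (by omega) (by omega)]; exact reg4 a ha v hv
  -- advance
  have e14 : m₅ 14 = g.RK - q := by
    rw [vfr 14 (by omega) (by omega) (by omega), ufr 14 (by omega) (by omega) (by omega),
      tfr 14 (by omega) (by omega) (by omega) (by omega), ifr 14 (by omega) (by omega) (by omega) (by omega),
      cfr 14 (by omega), s14]
  have e17 : m₅ 17 = q := by
    rw [vfr 17 (by omega) (by omega) (by omega), ufr 17 (by omega) (by omega) (by omega),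
      tfr 17 (by omega) (by omega) (by omega) (by omega), ifr 17 (by omega) (by omega) (by omega) (by omega),
      cfr 17 (by omega), s17]
  refine Achieves.seqs_cons (T₁ := 2) (T₂ := 0) ?_ (fun _ h => Achieves.seqs_nil h)
  refine CliqueRed.achieves_block_of_eq (fun m' hm' => ?_) le_rfl
  simp (disch := first | omega | decide) only [execOps_cons, execOps_nil, execOp, Operand.write,
    Operand.read, merge_apply_of_lt, update_merge_of_lt, Function.update_of_ne,
    BinOp.eval_add_of_lt, BinOp.eval_sub_of_le, e14, e17] at hm'
  subst hm'
  refine ⟨fun a ha => ?fr, ?_, ?_, ?_, ?_, fun a ha ha' => ?low, fun a ha => ?hash⟩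
  case fr =>
    rw [merge_apply_of_lt (by omega)]
    simp (disch := omega) only [Function.update_of_ne]
    exact reg5 a ha _ rfl
  case low =>
    rw [merge_apply_of_le ha, vfr a (by omega) (by omega) (by omega), uD a ha (by omega), tD a ha,
      ilow a ha ha']
  case hash =>
    rw [merge_apply_of_le (by omega), vfr a (by omega) (by omega) (by omega), uhash a ha,
      g.rstVal_n]
  all_goals (try simp (disch := first | omega | decide) only [merge_apply_of_lt,
    Function.update_self, Function.update_of_ne])
  · omega
  · exact v15
  · exact v16

/-- **The main loop** over the `RK = r^K` terms: `S⁺` and `S⁻` are computed; the counting array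
is zero again at the end of every term. [folklore] -/
theorem main_spec (hF : g.Fits W) (htb : g.tb.WF) {m₀ : ℕ → ℕ} (hR : g.Regs m₀) (h13 : m₀ 13 = g.RK)
    (h15 : m₀ 15 = 0) (h16 : m₀ 16 = 0) (h17 : m₀ 17 = 0)
    (hlow : ∀ a, 100 ≤ a → a < g.KA → m₀ a = g.codeMem a) (hhash : ∀ a, g.H0 ≤ a → m₀ a = 0) :
    Achieves W O (main g.tb) m₀ (g.MainInv m₀ g.RK) (g.RK * (g.Tq + 2) + 2) := by
  have hb := g.bases
  unfold main
  refine Achieves.mono (T := 1 + (g.RK * (g.Tq + 2) + 1)) ?_ (fun _ h => h) (by omega)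
  refine Achieves.seqs_cons (R := g.MainInv m₀ 0) (T₁ := 1) (T₂ := g.RK * (g.Tq + 2) + 1) ?_
    fun m₁ h₁ => ?_
  · refine CliqueRed.achieves_block_of_eq (fun m' hm' => ?_) le_rfl
    simp (disch := first | omega | decide) only [execOps_cons, execOps_nil, execOp, Operand.write,
      Operand.read, merge_apply_of_lt, update_merge_of_lt, BinOp.eval_band, Nat.and_self, h13] at hm'
    subst hm'
    refine ⟨fun a ha => ?_, ?_, ?_, ?_, ?_, fun a ha ha' => ?_, fun a ha => ?_⟩
    all_goals (try simp (disch := first | omega | decide) only [merge_apply_of_lt,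
      merge_apply_of_le, Function.update_self, Function.update_of_ne, Nat.sub_zero])
    · rw [h15]; rfl
    · rw [h16]; rfl
    · exact h17
    · exact hlow a ha ha'
    · exact hhash a ha
  refine Achieves.seqs_cons (T₁ := g.RK * (g.Tq + 2) + 1) (T₂ := 0) ?_ (fun _ h => Achieves.seqs_nil h)
  refine Achieves.whilenz g.RK g.Tq (fun q => g.MainInv m₀ q) (fun q hq m' hI => ⟨?_, ?_⟩)
    (fun m' hI => ?_) h₁ (fun _ h => h) le_rfl
  · simp only [Operand.read, hI.r14]; omega
  · exact g.qBody_spec hF htb hR hq hI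
  · simp only [Operand.read, hI.r14]; omega


/-! ### The read-out and the whole program -/

/-- **The read-out**: cell `1 :=` the output bit `[S⁺ ≠ S⁻]`, cell `0 := 1`. [folklore] -/
theorem output_spec (hW : 1 ≤ W) {m : ℕ → ℕ} (h15 : m 15 = g.Spos g.RK)
    (h16 : m 16 = g.Sneg g.RK) :
    Achieves W O output m (fun m' => readOut m' = [g.outBit]) 4 := by
  unfold output
  refine CliqueRed.achieves_block_of_eq (fun m' hm' => ?_) le_rfl
  have hb : (if g.Spos g.RK = g.Sneg g.RK then 1 else 0) ≤ 1 := by split_ifs <;> omega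
  have hW1 : (1 : ℕ) < 2 ^ W := Nat.one_lt_two_pow (by omega)
  simp (disch := first | omega | decide) only [execOps_cons, execOps_nil, execOp, Operand.write,
    Operand.read, merge_apply_of_lt, update_merge_of_lt, Function.update_self,
    BinOp.eval_eq, BinOp.eval_band, Nat.and_self, h15, h16] at hm'
  subst hm'
  unfold readOut
  rw [merge_apply_of_lt (by omega), Function.update_self]
  simp only [readSeg, List.range_one, List.map_cons, List.map_nil, Nat.add_zero, List.cons.injEq,
    and_true]
  rw [merge_apply_of_lt (by omega), Function.update_of_ne (by omega), Function.update_self]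
  unfold outBit
  by_cases h : g.Spos g.RK = g.Sneg g.RK
  · rw [if_pos h, if_pos h, BinOp.eval_sub_of_le (by omega) hW1]
  · rw [if_neg h, if_neg h, BinOp.eval_sub_of_le (by omega) hW1]

/-- The total running time of the program on the instance. [folklore] -/
def Ttotal : ℕ :=
  7 * g.L + 20 + (g.K * 4 + 1) + (2 * g.tb.tsz + 1) + (g.n * (g.d * 16 + 9) + 8) +
    (g.RK * (g.Tq + 2) + 2) + 4

/-- **The whole program**, as a total-correctness statement from the initial memory: it ends with
output `[outBit]` within `Ttotal` steps. [folklore] -/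
theorem prog_spec (hF : g.Fits W) (htb : g.tb.WF) :
    Achieves W O (prog g.tb) (initFun g.x) (fun m' => readOut m' = [g.outBit]) g.Ttotal := by
  obtain ⟨hX, hXL, hTU, hTV, hTC, hTS, hBA, hBB, hKA, hH0, htop, hxx, hdk, hrk, hbd, hprod, hL,
    hP, hnn⟩ := g.facts hF
  have hk := htb.k_pos
  have hL2 := g.two_le_L
  have hW : 1 ≤ W := le_trans (inputWidth_pos _) hF.width
  unfold prog Ttotal
  refine Achieves.mono (T := 7 * g.L + (20 + (g.K * 4 + 1 + (2 * g.tb.tsz + 1 +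
    (g.n * (g.d * 16 + 9) + 8 + (g.RK * (g.Tq + 2) + 2 + (4 + 0))))))) ?_ (fun _ h => h) (by omega)
  -- relocate
  refine Achieves.seqs_cons (R := fun m => m = relocated g.x) (T₁ := 7 * g.L) ?_ fun m₁ h₁ => ?_
  · intro qs
    exact ⟨_, _, le_rfl, relocate_exec (by unfold L at hL2; omega) hF.input
      (by unfold L X at *; omega) qs, rfl⟩
  subst h₁
  -- setup
  refine Achieves.seqs_cons (T₁ := 20) (g.setup_spec hF hk) fun m₂ h₂ => ?_
  obtain ⟨hR2, _, s13, s20, s15, s16, s17, sD⟩ := h₂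
  -- RK
  refine Achieves.seqs_cons (T₁ := g.K * 4 + 1) (g.rkLoop_spec hF hk s13 s20) fun m₃ h₃ => ?_
  obtain ⟨t13, _, tfr⟩ := h₃
  have hR3 : g.Regs m₃ := hR2.of_frame fun a ha => tfr a (by omega) (by omega)
  -- tables
  refine Achieves.seqs_cons (T₁ := 2 * g.tb.tsz + 1)
    (g.tables_spec hF htb hR3 fun a ha => by rw [tfr a (by omega) (by omega), sD a ha])
    fun m₄ h₄ => ?_
  obtain ⟨hR4, ufr, uD⟩ := h₄
  -- codes
  refine Achieves.seqs_cons (T₁ := g.n * (g.d * 16 + 9) + 8) (g.codes_spec hF hk hR4 uD)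
    fun m₅ h₅ => ?_
  obtain ⟨vfr, vD⟩ := h₅
  have hR5 : g.Regs m₅ := hR4.of_frame fun a ha => vfr a (by omega)
  have reg5 : ∀ a, a < 20 → a ≠ 13 → m₅ a = m₂ a := fun a ha ha' => by
    rw [vfr a ha, ufr a (by omega) (by omega), tfr a ha' (by omega)]
  -- main loop
  refine Achieves.seqs_cons (T₁ := g.RK * (g.Tq + 2) + 2)
    (g.main_spec hF htb hR5 (by rw [vfr 13 (by omega), ufr 13 (by omega) (by omega), t13])
      (by rw [reg5 15 (by omega) (by omega), s15]) (by rw [reg5 16 (by omega) (by omega), s16])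
      (by rw [reg5 17 (by omega) (by omega), s17]) (fun a ha _ => vD a ha)
      (fun a ha => by rw [vD a (by omega), g.codeMem_of_KA_le (by omega)]))
    fun m₆ h₆ => ?_
  -- read-out
  exact Achieves.seqs_cons (T₁ := 4) (T₂ := 0) (g.output_spec hW h₆.r15 h₆.r16)
    fun _ h => Achieves.seqs_nil h

/-- **The OV program halts with the output bit.** At a word size `W` with `g.Fits W`, the compiled
program outputs `[outBit]` on the input `x` within `Ttotal + 1` steps (any oracle, any coins).
[folklore] -/
theorem prog_outputsWithin (hF : g.Fits W) (htb : g.tb.WF) (ρ : ℕ → ℕ) :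
    OutputsWithin (prog g.tb).toProgram W O ρ g.x [g.outBit] (g.Ttotal + 1) := by
  obtain ⟨st, t, ht, hexec, hout, -⟩ := (g.prog_spec (O := O) hF htb).exists_exec
  rw [← init_mem_eq_initFun hF.width] at hexec
  rw [← hout]
  exact outputsWithin_toProgram hexec (by omega) ρ

end Params

end OVEq

end Literature.Computability.FineGrained
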